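import Summits.QuantumFields.YangMills.Theorems.AlphaInputsT3ACv3LinearAvgMatrix
import Summits.QuantumFields.YangMills.Theorems.UnitScaleTiltProp7IterLinearisationFlat
import HarnessLib

/-!
# `AlphaInputsT3ACv3EMLIterFirstOrderUniform` — STRATEGY B for 2′, non-abelian (FL) input: **[Balaban1985Averaging] PROPOSITION 4 (134)–(135) AT THE FLAT BACKGROUND FOR THE
# (0.4) AVERAGING OF RECORD WITH A `k`-UNIFORM CONSTANT** — `‖Ū^{(s)}(c) − 1 − (Q^{(s)}Y)(c)‖ ≤ 324·L·(d+2)²·m_s²`, `m_s = 2|n|²(d+1)·L^s·δ`, for every `s ≤ k`, under ONE smallness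
# condition on `m_k` (so on `L^k·δ`, the natural scale) and `d + 2 ≤ L` — lane `pub-balaban3d` ∕ cell `ym3-torus`, seat `ym-ust-19936-w1` (g0)

WHY (HOME `ym-ust-19936-w1/NONABELIAN-FL-ARCH-w1-g0.md` §8; this seat's PROGRESS 5–6).  Every kinematic route to (FL) starts from a candidate `U = exp(lift)` whose `k`-fold (0.4)-averages
must be the datum up to a defect QUADRATIC in the datum and UNIFORM in `k` (print's Prop. 4: «`|C_k(U₀, A)| ≦ C₂|A|²`», `C₂` independent of `k`).  The tree's flat `k`-fold statement
`Prop7AvgLinearisation.norm_iter_sub_one_sub_iterLin_le` (19200 lineage) iterates the one-step bound with the one-step operator norm `3ℓ`, whence smallness `81ℓ(4ℓ)^kδ ≤ 1` and remainder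
`k·81ℓ²(4ℓ)^{2k}δ²` — exponentially off the natural scale `L^k δ`.  Print's device ((130)–(133) p.38) is to measure the main term by its TRUE size `|Q^{(s)}Y| ≲ L^s|Y|` (here:
`…v3LinearAvgMatrix.norm_iterLin_le`, from the telescoped coboundary potential of `…v3LinearAvgSup`) and to let the geometric growth `L^{2s}` of the squared main term dominate the one-step
amplification `(d+1)L` of earlier remainders — which it does as soon as `d + 2 ≤ L`.
WHAT IS HERE (no definition; `Q` any family with `Q 0 = id`, `Q (s+1) Y c = linAvg (Q s Y) c`).  §1 `norm_linAvg_le_sharp` (`‖(Q₁Y)(c)‖ ≤ (d+1)L·M`: two staircases of `≤ d⌊(L−1)∕2⌋` steps and a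
segment of `L`); §2 `main_scale_mono`, `step_dominates` (the remainder recursion `r_{s+1} = (d+1)L·r_s + 324ℓ²m_s²` keeps the closed form `r_s ≤ 324L(d+2)²m_s²` when `d + 2 ≤ L`);
§3 ★★ `norm_iter_sub_one_sub_iterLin_le_uniform` (the title) with the companion first-order size `‖Ū^{(s)}(c) − 1‖ ≤ 2m_s`.
HONEST FRAMING.  Flat background only (print's Prop. 4 is at a small-field background `U₀`); count-neutral helper toward R3 2′ (items 19936∕19935); (FL) NOT proved; registry untouched;
nothing about d = 4, the continuum, or a mass gap; YM₃ on T³ is rung R3, not Clay.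

References: T. Bałaban, Commun. Math. Phys. 98 (1985) 17–51 [Balaban1985Averaging] (Prop. 3 (122)–(123) p.36, (127)–(133) pp.37–38, Prop. 4 (134)–(135) p.38); CMP 109 (1987) 249–301
[Balaban1987RG1] ((0.4), (0.11) p.253).
-/

set_option autoImplicit false

noncomputable section

namespace Summit.QuantumFields.YangMills.Theorems.EMLIterUniform

open Finset
open scoped Matrix.Norms.L2Operator
open Literature.MathematicalPhysics.QuantumFieldTheory.Balaban1983to89
open T4Continuum AveragingRT BlockAveraging ExpMeanLog BlockAveragingEMLLinearised
open Literature.MathematicalPhysics.QuantumFieldTheory.Balaban1983to89.LatticeWordStokes (length_stairWord_le)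
open Summit.QuantumFields.YangMills.Theorems.Prop7LinAvgOnto (linAvg_add norm_walkSum_le)
open Summit.QuantumFields.YangMills.Theorems.Prop7AvgLinearisation (iter_zero_apply' iter_succ_eq_avgFun')
open Summit.QuantumFields.YangMills.Theorems.Prop7HolRatioPerStep (norm_mean_le')
open Summit.QuantumFields.YangMills.Theorems.LinearAvgSup (natAbs_off_le cast_half_eq)
open Summit.QuantumFields.YangMills.Theorems.LinearAvgMatrix (norm_iterLin_le)

variable {P : Params} {j : ℕ} {n : Type*} [Fintype n] [DecidableEq n] [Nonempty n]

/-! ## §1 The sharp one-step sup bound of the linearised average -/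

omit [Nonempty n] in
/-- **`‖(Q₁Y)(c)‖ ≤ (d+1)·L·M`** when `‖Y_b‖ ≤ M`: the two staircases of (0.3) have at most `d⌊(L−1)∕2⌋` steps each, the segment `L`. [cite: Balaban1985Averaging, (124)–(125) p.36] -/
theorem norm_linAvg_le_sharp (Y : PBond P j → Matrix n n ℂ) {M : ℝ} (hM : 0 ≤ M) (hY : ∀ b, ‖Y b‖ ≤ M) (c : PBond P (j + 1)) :
    ‖linAvg Y c‖ ≤ ((P.d : ℝ) + 1) * (P.L : ℝ) * M := by
  have hstair : ∀ (x : Site P j) (σ : Equiv.Perm (Fin P.d)) (r : Fin P.d → Fin P.L),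
      ‖walkSum Y (walk x (stairWord σ (off r)))‖ ≤ ((P.d * ((P.L - 1) / 2) : ℕ) : ℝ) * M := by
    intro x σ r
    refine (norm_walkSum_le Y hY _).trans (mul_le_mul_of_nonneg_right ?_ hM)
    rw [length_walk]
    exact_mod_cast length_stairWord_le σ (off r) _ fun ν => natAbs_off_le r ν
  have hseg : ∀ (x : Site P j) (μ : Fin P.d), ‖walkSum Y (walk x (List.replicate P.L (μ, true)))‖ ≤ (P.L : ℝ) * M := by
    intro x μ
    refine (norm_walkSum_le Y hY _).trans (le_of_eq ?_)
    rw [length_walk, List.length_replicate]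
  rw [linAvg_def]
  refine norm_mean_le' fun i => ?_
  have h1 := hstair (emb c.src) i.2.1 i.1
  have h2 := hseg (walkEnd (emb c.src) (stairWord i.2.1 (off i.1))) c.dir
  have h3 := hstair (emb c.tgt) i.2.2 i.1
  have hhalf : (2 : ℝ) * ((((P.L - 1) / 2 : ℕ)) : ℝ) = (P.L : ℝ) - 1 := by rw [cast_half_eq]; ring
  have hd : (0 : ℝ) ≤ P.d := Nat.cast_nonneg _
  calc ‖walkSum Y (walk (emb c.src) (stairWord i.2.1 (off i.1))) +
          walkSum Y (walk (walkEnd (emb c.src) (stairWord i.2.1 (off i.1))) (List.replicate P.L (c.dir, true))) -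
          walkSum Y (walk (emb c.tgt) (stairWord i.2.2 (off i.1)))‖
      ≤ ((P.d * ((P.L - 1) / 2) : ℕ) : ℝ) * M + (P.L : ℝ) * M + ((P.d * ((P.L - 1) / 2) : ℕ) : ℝ) * M := by
        refine (norm_sub_le _ _).trans (add_le_add ((norm_add_le _ _).trans (add_le_add h1 h2)) h3)
    _ = ((P.d : ℝ) * ((P.L : ℝ) - 1) + P.L) * M := by push_cast; rw [← hhalf]; ring
    _ ≤ ((P.d : ℝ) + 1) * (P.L : ℝ) * M := by nlinarith

/-! ## §2 The remainder recursion and its geometric domination -/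

omit [DecidableEq n] [Nonempty n] in
/-- The one natural scale `m_s = 2|n|²·(d+1)·L^s·δ` (the sup bound of the `s`-fold main term, `…v3LinearAvgMatrix.norm_iterLin_le`) is monotone in `s`. [cite: Balaban1985Averaging, (130)–(131) p.38] -/
theorem main_scale_mono {δ : ℝ} (hδ : 0 ≤ δ) {s k : ℕ} (hs : s ≤ k) :
    2 * (Fintype.card n : ℝ) ^ 2 * (((P.d : ℝ) + 1) * (P.L : ℝ) ^ s * δ) ≤ 2 * (Fintype.card n : ℝ) ^ 2 * (((P.d : ℝ) + 1) * (P.L : ℝ) ^ k * δ) := by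
  have hL1 : (1 : ℝ) ≤ P.L := by exact_mod_cast P.hL.2.le
  have hpow : (P.L : ℝ) ^ s ≤ (P.L : ℝ) ^ k := pow_le_pow_right₀ hL1 hs
  have hd : (0 : ℝ) ≤ (P.d : ℝ) + 1 := by positivity
  have : ((P.d : ℝ) + 1) * (P.L : ℝ) ^ s * δ ≤ ((P.d : ℝ) + 1) * (P.L : ℝ) ^ k * δ :=
    mul_le_mul_of_nonneg_right (mul_le_mul_of_nonneg_left hpow hd) hδ
  exact mul_le_mul_of_nonneg_left this (by positivity)

/-- **THE GEOMETRIC DOMINATION**: with `C = 324·L·(d+2)²`, `ℓ = (d+2)L` and `d + 2 ≤ L`, one step of the remainder recursion keeps the closed form —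
`(d+1)L·(C·m²) + 324ℓ²·m² ≤ C·(L·m)²`. [cite: Balaban1985Averaging, (132)–(133) p.38] -/
theorem step_dominates (hL : P.d + 2 ≤ P.L) (m : ℝ) :
    ((P.d : ℝ) + 1) * (P.L : ℝ) * (324 * (P.L : ℝ) * ((P.d : ℝ) + 2) ^ 2 * m ^ 2) + 324 * (((P.d + 2) * P.L : ℕ) : ℝ) ^ 2 * m ^ 2 ≤
      324 * (P.L : ℝ) * ((P.d : ℝ) + 2) ^ 2 * ((P.L : ℝ) * m) ^ 2 := by
  have hL' : (P.d : ℝ) + 2 ≤ (P.L : ℝ) := by exact_mod_cast hL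
  have hL0 : (0 : ℝ) ≤ P.L := Nat.cast_nonneg _
  have hkey : 0 ≤ 324 * (P.L : ℝ) ^ 2 * ((P.d : ℝ) + 2) ^ 2 * m ^ 2 * ((P.L : ℝ) - ((P.d : ℝ) + 2)) := by
    have : (0 : ℝ) ≤ (P.L : ℝ) - ((P.d : ℝ) + 2) := by linarith
    positivity
  push_cast
  nlinarith [hkey]

/-! ## §3 Proposition 4 at the flat background with a `k`-uniform constant -/

/-- **★★ [Balaban1985Averaging] PROP. 4 (134)–(135) AT THE FLAT BACKGROUND, `k`-UNIFORM.**  Let `Q` be any family with `Q 0 Y = Y`, `Q (s+1) Y c = linAvg (Q s Y) c`, let `d + 2 ≤ L`, and let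
`U` be an `SU(N)` field on the finest lattice with `‖U_b − 1‖ ≤ δ`; put `Y = U − 1`, `m_s = 2|n|²(d+1)·L^s·δ`, `ℓ = (d+2)L`.  If `324·L·(d+2)²·m_k ≤ 1` and `4ℓ·m_k < δ_N` then for every `s ≤ k` and every
level-`s` bond `c`:  `‖Ū^{(s)}(c) − 1‖ ≤ 2m_s` and `‖Ū^{(s)}(c) − 1 − (Q^{(s)}Y)(c)‖ ≤ 324·L·(d+2)²·m_s²` — the second-order remainder is measured on the natural scale `m_s ≍ L^s δ` with a
constant INDEPENDENT of `s` and `k` (print: «`|C_k(U₀, A)| ≦ C₂|A|²`»).  Induction: the level-`s` field is `1 + Q^{(s)}Y + D_s` with `‖Q^{(s)}Y‖ ≤ m_s` (`norm_iterLin_le`) and `‖D_s‖ ≤ C m_s² ≤ m_s`,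
so the one-step Prop. 3 (`norm_avgFun_sub_one_sub_linAvg_le` at `2m_s`) and `Q₁(Q^{(s)}Y + D_s) = Q^{(s+1)}Y + Q₁D_s` (`‖Q₁D_s‖ ≤ (d+1)L·C m_s²`, §1) give `‖D_{s+1}‖ ≤ (d+1)L·C m_s² + 324ℓ² m_s² ≤
C m_{s+1}²` (§2). [cite: Balaban1985Averaging, Prop. 4 (134)–(135) p.38, (127)–(133) pp.37–38; Balaban1987RG1, (0.4)+(0.11) p.253] -/
theorem norm_iter_sub_one_sub_iterLin_le_uniform
    (Q : (i : ℕ) → (PBond P 0 → Matrix n n ℂ) → PBond P i → Matrix n n ℂ)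
    (hQ0 : ∀ Y, Q 0 Y = Y) (hQs : ∀ (i : ℕ) (Y : PBond P 0 → Matrix n n ℂ) (c : PBond P (i + 1)), Q (i + 1) Y c = linAvg (Q i Y) c)
    (hL : P.d + 2 ≤ P.L) (U : GaugeField P 0 (Matrix.specialUnitaryGroup n ℂ)) {δ : ℝ} (hδ : 0 ≤ δ)
    (hU : ∀ b, ‖((U b : Matrix.specialUnitaryGroup n ℂ) : Matrix n n ℂ) - 1‖ ≤ δ) (k : ℕ)
    (hm : 324 * (P.L : ℝ) * ((P.d : ℝ) + 2) ^ 2 * (2 * (Fintype.card n : ℝ) ^ 2 * (((P.d : ℝ) + 1) * (P.L : ℝ) ^ k * δ)) ≤ 1)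
    (hN : 4 * (((P.d + 2) * P.L : ℕ) : ℝ) * (2 * (Fintype.card n : ℝ) ^ 2 * (((P.d : ℝ) + 1) * (P.L : ℝ) ^ k * δ)) < deltaSU n) :
    ∀ s : ℕ, s ≤ k → ∀ c : PBond P s,
      ‖((Averaging.iter (fun i => blockAvg (P := P) (j := i) (expMeanLogSU (n := n))) s U c : Matrix.specialUnitaryGroup n ℂ) : Matrix n n ℂ) - 1‖ ≤
          2 * (2 * (Fintype.card n : ℝ) ^ 2 * (((P.d : ℝ) + 1) * (P.L : ℝ) ^ s * δ)) ∧
      ‖((Averaging.iter (fun i => blockAvg (P := P) (j := i) (expMeanLogSU (n := n))) s U c : Matrix.specialUnitaryGroup n ℂ) : Matrix n n ℂ) - 1 -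
          Q s (fun b => ((U b : Matrix.specialUnitaryGroup n ℂ) : Matrix n n ℂ) - 1) c‖ ≤
        324 * (P.L : ℝ) * ((P.d : ℝ) + 2) ^ 2 * (2 * (Fintype.card n : ℝ) ^ 2 * (((P.d : ℝ) + 1) * (P.L : ℝ) ^ s * δ)) ^ 2 := by
  -- letters
  set ℓ : ℝ := (((P.d + 2) * P.L : ℕ) : ℝ) with hℓ
  set C : ℝ := 324 * (P.L : ℝ) * ((P.d : ℝ) + 2) ^ 2 with hC
  set Y : PBond P 0 → Matrix n n ℂ := fun b => ((U b : Matrix.specialUnitaryGroup n ℂ) : Matrix n n ℂ) - 1 with hY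
  let m : ℕ → ℝ := fun s => 2 * (Fintype.card n : ℝ) ^ 2 * (((P.d : ℝ) + 1) * (P.L : ℝ) ^ s * δ)
  have hm_def : ∀ s, m s = 2 * (Fintype.card n : ℝ) ^ 2 * (((P.d : ℝ) + 1) * (P.L : ℝ) ^ s * δ) := fun s => rfl
  have hL0 : (0 : ℝ) ≤ P.L := Nat.cast_nonneg _
  have hL1 : (1 : ℝ) ≤ P.L := by exact_mod_cast P.hL.2.le
  have hℓeq : ℓ = ((P.d : ℝ) + 2) * P.L := by rw [hℓ]; push_cast; ring
  have hd0 : (0 : ℝ) ≤ P.d := Nat.cast_nonneg _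
  have hC0 : 0 ≤ C := by positivity
  have hm0 : ∀ s, 0 ≤ m s := fun s => by rw [hm_def]; positivity
  have hmsucc : ∀ s, m (s + 1) = (P.L : ℝ) * m s := fun s => by rw [hm_def, hm_def, pow_succ]; ring
  have hmono : ∀ s, s ≤ k → m s ≤ m k := fun s hs => main_scale_mono (n := n) hδ hs
  have hYδ : ∀ b, ‖Y b‖ ≤ δ := hU
  -- the main term on its natural scale
  have hmain : ∀ (s : ℕ) (c : PBond P s), ‖Q s Y c‖ ≤ m s := fun s c => norm_iterLin_le Q hQ0 hQs Y hYδ s c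
  -- the induction, carrying the closed-form remainder bound
  have key : ∀ s : ℕ, s ≤ k → ∀ c : PBond P s,
      ‖((Averaging.iter (fun i => blockAvg (P := P) (j := i) (expMeanLogSU (n := n))) s U c : Matrix.specialUnitaryGroup n ℂ) : Matrix n n ℂ) - 1 -
          Q s Y c‖ ≤ C * (m s) ^ 2 := by
    intro s
    induction s with
    | zero =>
      intro _ c
      rw [iter_zero_apply', hQ0, sub_self, norm_zero]
      positivity
    | succ s ih =>
      intro hsk c
      have hs : s ≤ k := (Nat.le_succ s).trans hsk
      have ihs := ih hs
      -- sizes at level `s`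
      have hCm : C * m s ≤ 1 := (mul_le_mul_of_nonneg_left (hmono s hs) hC0).trans hm
      have hDm : C * (m s) ^ 2 ≤ m s := by
        have : C * (m s) ^ 2 = (C * m s) * m s := by ring
        rw [this]; exact (mul_le_mul_of_nonneg_right hCm (hm0 s)).trans_eq (one_mul _)
      set W : GaugeField P s (Matrix.specialUnitaryGroup n ℂ) :=
        Averaging.iter (fun i => blockAvg (P := P) (j := i) (expMeanLogSU (n := n))) s U with hW
      set D : PBond P s → Matrix n n ℂ := fun b => ((W b : Matrix.specialUnitaryGroup n ℂ) : Matrix n n ℂ) - 1 - Q s Y b with hD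
      have hDb : ∀ b, ‖D b‖ ≤ C * (m s) ^ 2 := fun b => ihs b
      have hW1 : ∀ b, ‖((W b : Matrix.specialUnitaryGroup n ℂ) : Matrix n n ℂ) - 1‖ ≤ 2 * m s := fun b => by
        have e : ((W b : Matrix.specialUnitaryGroup n ℂ) : Matrix n n ℂ) - 1 = Q s Y b + D b := by
          simp only [hD]; rw [add_sub_cancel]
        rw [e]
        exact (norm_add_le _ _).trans (by linarith [hmain s b, hDb b, hDm])
      -- the one-step hypotheses at scale `2 m_s`
      have h2m0 : 0 ≤ 2 * m s := by linarith [hm0 s]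
      have h16 : 16 * (ℓ * (2 * m s)) ≤ 1 := by
        have h1 : 32 * ℓ ≤ C := by
          rw [hℓeq, hC]
          have : (0 : ℝ) ≤ (P.d : ℝ) + 2 := by positivity
          nlinarith [mul_nonneg this hL0]
        have h2 : 16 * (ℓ * (2 * m s)) = (32 * ℓ) * m s := by ring
        rw [h2]
        exact (mul_le_mul_of_nonneg_right h1 (hm0 s)).trans hCm
      have hNs : 2 * (ℓ * (2 * m s)) < deltaSU n := by
        have : 2 * (ℓ * (2 * m s)) ≤ 4 * ℓ * m k := by
          have hℓ0 : 0 ≤ ℓ := by rw [hℓ]; exact Nat.cast_nonneg _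
          nlinarith [hmono s hs, hℓ0]
        exact this.trans_lt hN
      have hone := norm_avgFun_sub_one_sub_linAvg_le (n := n) W h2m0 hW1 h16 hNs c
      -- `Q₁(W − 1) = Q^{(s+1)}Y + Q₁ D`
      have hsplit : linAvg (fun b => ((W b : Matrix.specialUnitaryGroup n ℂ) : Matrix n n ℂ) - 1) c = Q (s + 1) Y c + linAvg D c := by
        have e : (fun b => ((W b : Matrix.specialUnitaryGroup n ℂ) : Matrix n n ℂ) - 1) = fun b => Q s Y b + D b := by
          funext b; simp only [hD]; rw [add_sub_cancel]
        rw [e, linAvg_add, hQs]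
      have hlinD : ‖linAvg D c‖ ≤ ((P.d : ℝ) + 1) * (P.L : ℝ) * (C * (m s) ^ 2) :=
        norm_linAvg_le_sharp D (by positivity) hDb c
      rw [iter_succ_eq_avgFun']
      have e2 : ((avgFun (expMeanLogSU (n := n)) W c : Matrix.specialUnitaryGroup n ℂ) : Matrix n n ℂ) - 1 - Q (s + 1) Y c =
          (((avgFun (expMeanLogSU (n := n)) W c : Matrix.specialUnitaryGroup n ℂ) : Matrix n n ℂ) - 1 -
            linAvg (fun b => ((W b : Matrix.specialUnitaryGroup n ℂ) : Matrix n n ℂ) - 1) c) + linAvg D c := by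
        rw [hsplit]; abel
      rw [e2]
      calc ‖(((avgFun (expMeanLogSU (n := n)) W c : Matrix.specialUnitaryGroup n ℂ) : Matrix n n ℂ) - 1 -
              linAvg (fun b => ((W b : Matrix.specialUnitaryGroup n ℂ) : Matrix n n ℂ) - 1) c) + linAvg D c‖
          ≤ 81 * (ℓ * (2 * m s)) ^ 2 + ((P.d : ℝ) + 1) * (P.L : ℝ) * (C * (m s) ^ 2) := (norm_add_le _ _).trans (add_le_add hone hlinD)
        _ = ((P.d : ℝ) + 1) * (P.L : ℝ) * (324 * (P.L : ℝ) * ((P.d : ℝ) + 2) ^ 2 * (m s) ^ 2) + 324 * ℓ ^ 2 * (m s) ^ 2 := by rw [hC]; ring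
        _ ≤ 324 * (P.L : ℝ) * ((P.d : ℝ) + 2) ^ 2 * ((P.L : ℝ) * m s) ^ 2 := step_dominates hL (m s)
        _ = C * (m (s + 1)) ^ 2 := by rw [hmsucc, hC]
  -- assemble
  intro s hs c
  have h2 := key s hs c
  refine ⟨?_, h2⟩
  have hCm : C * m s ≤ 1 := (mul_le_mul_of_nonneg_left (hmono s hs) hC0).trans hm
  have hDm : C * (m s) ^ 2 ≤ m s := by
    have : C * (m s) ^ 2 = (C * m s) * m s := by ring
    rw [this]; exact (mul_le_mul_of_nonneg_right hCm (hm0 s)).trans_eq (one_mul _)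
  have e : ((Averaging.iter (fun i => blockAvg (P := P) (j := i) (expMeanLogSU (n := n))) s U c : Matrix.specialUnitaryGroup n ℂ) : Matrix n n ℂ) - 1 =
      Q s Y c + (((Averaging.iter (fun i => blockAvg (P := P) (j := i) (expMeanLogSU (n := n))) s U c : Matrix.specialUnitaryGroup n ℂ) : Matrix n n ℂ) - 1 - Q s Y c) := by
    abel
  rw [e]
  exact (norm_add_le _ _).trans (by linarith [hmain s c])

end Summit.QuantumFields.YangMills.Theorems.EMLIterUniform

end
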